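import Literature.Geometry.Riemannian.BakryEmeryHeatFlow
import Literature.Geometry.Riemannian.ShrinkerEntropyProofs
import Literature.Geometry.Lorentzian.GreenIdentityCompactSupport
import HarnessLib

/-!
# Weighted Green identities with one compactly supported factor on a (non-compact) manifold
# (crux `EntropyRung.NoncompactShrinkerGap`, stmt-SmoothPoincare4-10868, line `collapsed-ends-usc`, v13)

Helpers of the registered stub `stub_compactSupportLSI` (the compact-support logarithmic Sobolev inequality of
the shrinker measure, proved by the Bakry–Émery heat flow on the complete shrinker). Every integration by parts
of that argument is one of the two identities below: for a Riemannian manifold `(M, g)` modelled on `ℝⁿ`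
(Hausdorff, second countable — NOT compact), a smooth weight `V`, the weighted Laplacian
`L b = Δ_g b − g⁻¹(dV, db)` and the weighted measure `dm = e^{-V} dV_g`,

  `∫ a (L b) dm = −∫ g⁻¹(da, db) dm`

whenever `a ∈ C¹`, `b ∈ C²` and EITHER `a` (`helper_weightedGreen_left`) OR `b`
(`helper_weightedGreen_right`) has compact support. Proof: Green's first identity for compactly supported
functions on a non-compact manifold (`GreenIdentityCompactSupport.lean`:
`integral_mul_dalembertian_eq_neg_integral_innerDual_of_hasCompactSupport` / `…_right`) applied to
`u = a e^{-V}`, and `d(a e^{-V}) = e^{-V} da − a e^{-V} dV` (`mvfderiv_mul_exp_neg_toLinearMap`); the closed-manifold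
version is `integral_mul_weightedLaplacian` (`BakryEmeryHeatFlow.lean`). Everything is proved; no definitions.

References: Carrillo–Ni 2009, §3–§4 (integration by parts on the complete soliton); Bakry–Gentil–Ledoux 2014,
§3.1 (`∫ f Lg dμ = −∫ Γ(f,g) dμ`).
-/

noncomputable section

set_option linter.dupNamespace false

open scoped Manifold ContDiff ENNReal NNReal Topology
open MeasureTheory Set Filter
open Literature.Geometry.Lorentzian Literature.Geometry.Riemannian

namespace Summit.SmoothPoincare4.SmoothPoincare4.Theorems.NoncompactShrinkerGapHeat

section Green

variable {n : ℕ} {M : Type*} [TopologicalSpace M] [T2Space M] [SecondCountableTopology M]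
  [ChartedSpace (EuclideanSpace ℝ (Fin n)) M] [IsManifold (𝓡 n) ∞ M] [T3Space M] [MeasurableSpace M]
  [BorelSpace M]
  {g : PseudoRiemannianMetric (𝓡 n) ∞ (EuclideanSpace ℝ (Fin n)) (TangentSpace (𝓡 n) : M → Type _)}
  [g.HasLeviCivita]

omit [T2Space M] [SecondCountableTopology M] [T3Space M] [MeasurableSpace M] [BorelSpace M] [g.HasLeviCivita] in
/-- Continuous functions with compact support times anything continuous: `x ↦ F x * G x` has compact support
if `F` has. [folklore] -/
theorem hasCompactSupport_mul_of_left {F G : M → ℝ} (hF : HasCompactSupport F) :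
    HasCompactSupport fun x ↦ F x * G x :=
  hF.mul_right

/-- **Green's first identity for a compactly supported first factor, in the `riemVolume` vocabulary**:
`∫ u Δ_g w dV_g = −∫ g⁻¹(du, dw) dV_g` for `u ∈ C¹_c(M)`, `w ∈ C²(M)` on a (non-compact) Riemannian manifold
modelled on `ℝⁿ` (`integral_mul_dalembertian_eq_neg_integral_innerDual_of_hasCompactSupport` through
`riemVolume_eq`). [cite: Lee2018, Problem 2-23 (a)] -/
theorem integral_mul_dalembertian_of_hasCompactSupport_left (hg : g.IsRiemannian) {u w : M → ℝ}
    (hu : ContMDiff (𝓡 n) 𝓘(ℝ, ℝ) 1 u) (huc : HasCompactSupport u) (hw : ContMDiff (𝓡 n) 𝓘(ℝ, ℝ) 2 w) :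
    ∫ x, u x * g.dalembertian w x ∂g.riemVolume =
      -∫ x, g.innerDual x (mvfderiv (𝓡 n) u x).toLinearMap (mvfderiv (𝓡 n) w x).toLinearMap
        ∂g.riemVolume := by
  haveI : LocallyCompactSpace M := ChartedSpace.locallyCompactSpace (EuclideanSpace ℝ (Fin n)) M
  haveI := (PseudoRiemannianMetric.ofRiemannian (g.toContMDiffRiemannianMetric hg)).hasLeviCivita
  have h1 := integral_mul_dalembertian_eq_neg_integral_innerDual_of_hasCompactSupport
    (g.toContMDiffRiemannianMetric hg) hu huc hw
  rw [PseudoRiemannianMetric.riemVolume_eq hg]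
  exact h1

/-- **Green's first identity for a compactly supported second factor, in the `riemVolume` vocabulary**:
`∫ u Δ_g w dV_g = −∫ g⁻¹(du, dw) dV_g` for `u ∈ C¹(M)`, `w ∈ C²_c(M)`.
[cite: Lee2018, Problem 2-23 (a)] -/
theorem integral_mul_dalembertian_of_hasCompactSupport_right (hg : g.IsRiemannian) {u w : M → ℝ}
    (hu : ContMDiff (𝓡 n) 𝓘(ℝ, ℝ) 1 u) (hw : ContMDiff (𝓡 n) 𝓘(ℝ, ℝ) 2 w) (hwc : HasCompactSupport w) :
    ∫ x, u x * g.dalembertian w x ∂g.riemVolume =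
      -∫ x, g.innerDual x (mvfderiv (𝓡 n) u x).toLinearMap (mvfderiv (𝓡 n) w x).toLinearMap
        ∂g.riemVolume := by
  haveI : LocallyCompactSpace M := ChartedSpace.locallyCompactSpace (EuclideanSpace ℝ (Fin n)) M
  haveI := (PseudoRiemannianMetric.ofRiemannian (g.toContMDiffRiemannianMetric hg)).hasLeviCivita
  have h1 := integral_mul_dalembertian_eq_neg_integral_innerDual_of_hasCompactSupport_right
    (g.toContMDiffRiemannianMetric hg) hu hw hwc
  rw [PseudoRiemannianMetric.riemVolume_eq hg]
  exact h1

omit [T2Space M] [SecondCountableTopology M] [g.HasLeviCivita] in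
/-- Continuous compactly supported functions are integrable for `g.riemVolume` (finite on compact sets).
[folklore] -/
theorem integrable_of_continuous_of_hasCompactSupport' (hg : g.IsRiemannian) {F : M → ℝ}
    (hF : Continuous F) (hFc : HasCompactSupport F) : Integrable F g.riemVolume := by
  haveI := CarrilloNi2009_shrinkerLSI.isFiniteMeasureOnCompacts_riemVolume hg
  exact hF.integrable_of_hasCompactSupport hFc

omit [T2Space M] [SecondCountableTopology M] [T3Space M] [MeasurableSpace M] [BorelSpace M] [g.HasLeviCivita] in
/-- The covector field `g⁻¹(du, dw)` vanishes off the support of `u`. [folklore] -/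
theorem innerDual_mvfderiv_eq_zero_of_notMem_tsupport_left {u w : M → ℝ} {x : M} (hx : x ∉ tsupport u) :
    g.innerDual x (mvfderiv (𝓡 n) u x).toLinearMap (mvfderiv (𝓡 n) w x).toLinearMap = 0 := by
  rw [mvfderiv_eq_zero_of_notMem_tsupport hx]
  simp [PseudoRiemannianMetric.innerDual]

omit [T2Space M] [SecondCountableTopology M] [T3Space M] [MeasurableSpace M] [BorelSpace M] [g.HasLeviCivita] in
/-- The covector field `g⁻¹(du, dw)` vanishes off the support of `w`. [folklore] -/
theorem innerDual_mvfderiv_eq_zero_of_notMem_tsupport_right {u w : M → ℝ} {x : M} (hx : x ∉ tsupport w) :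
    g.innerDual x (mvfderiv (𝓡 n) u x).toLinearMap (mvfderiv (𝓡 n) w x).toLinearMap = 0 := by
  rw [mvfderiv_eq_zero_of_notMem_tsupport hx]
  simp [PseudoRiemannianMetric.innerDual]

/-- **Weighted Green identity, compactly supported first factor**: `∫ a (L b) e^{-V} dV = −∫ g⁻¹(da, db) e^{-V} dV`
for `a ∈ C¹_c`, `b ∈ C²`, `V ∈ C¹`, `L b = Δ b − g⁻¹(dV, db)`, on a (non-compact) Riemannian manifold modelled on
`ℝⁿ`. [cite: CarrilloNi2009, §4 (integration by parts on the complete soliton)] -/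
theorem weightedGreen_left (hg : g.IsRiemannian) {a b V : M → ℝ}
    (ha : ContMDiff (𝓡 n) 𝓘(ℝ, ℝ) 1 a) (hac : HasCompactSupport a) (hb : ContMDiff (𝓡 n) 𝓘(ℝ, ℝ) 2 b)
    (hV : ContMDiff (𝓡 n) 𝓘(ℝ, ℝ) 1 V) :
    ∫ x, a x * (g.dalembertian b x
        - g.innerDual x (mvfderiv (𝓡 n) V x).toLinearMap (mvfderiv (𝓡 n) b x).toLinearMap) *
        Real.exp (-V x) ∂g.riemVolume =
      -∫ x, g.innerDual x (mvfderiv (𝓡 n) a x).toLinearMap (mvfderiv (𝓡 n) b x).toLinearMap *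
          Real.exp (-V x) ∂g.riemVolume := by
  -- Green's first identity for `u = a e^{-V}` (compactly supported) and `f = b`
  have hexp : ContMDiff (𝓡 n) 𝓘(ℝ, ℝ) 1 (fun y ↦ Real.exp (-V y)) :=
    ((Real.contDiff_exp.comp contDiff_neg).of_le le_top).comp_contMDiff hV
  have hu : ContMDiff (𝓡 n) 𝓘(ℝ, ℝ) 1 (fun y ↦ a y * Real.exp (-V y)) := ha.mul hexp
  have huc : HasCompactSupport (fun y ↦ a y * Real.exp (-V y)) := hac.mul_right
  have hG := integral_mul_dalembertian_of_hasCompactSupport_left hg hu huc hb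
  have hb1 : ContMDiff (𝓡 n) 𝓘(ℝ, ℝ) 1 b := hb.of_le (by norm_num)
  -- the integrand of the right-hand side of Green, pointwise
  have hpt : ∀ x, g.innerDual x (mvfderiv (𝓡 n) (fun y ↦ a y * Real.exp (-V y)) x).toLinearMap
        (mvfderiv (𝓡 n) b x).toLinearMap =
      g.innerDual x (mvfderiv (𝓡 n) a x).toLinearMap (mvfderiv (𝓡 n) b x).toLinearMap * Real.exp (-V x)
        - a x * g.innerDual x (mvfderiv (𝓡 n) V x).toLinearMap (mvfderiv (𝓡 n) b x).toLinearMap *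
            Real.exp (-V x) := by
    intro x
    have h := mvfderiv_mul_exp_neg_toLinearMap (I := 𝓡 n) (ha.mdifferentiableAt one_ne_zero (x := x))
      (hV.mdifferentiableAt one_ne_zero)
    rw [show (mvfderiv (𝓡 n) (fun y ↦ a y * Real.exp (-V y)) x).toLinearMap =
        (mvfderiv (𝓡 n) (fun y ↦ a y * Real.exp (-V y)) x : TangentSpace (𝓡 n) x →ₗ[ℝ] ℝ) from rfl, h,
      g.innerDual_sub_left, g.innerDual_smul_left, g.innerDual_smul_left]
    ring
  -- continuity, supports, integrability
  have hΔc : Continuous (g.dalembertian b) := continuous_dalembertian g hb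
  have hIVc : Continuous fun x ↦ g.innerDual x (mvfderiv (𝓡 n) V x).toLinearMap
      (mvfderiv (𝓡 n) b x).toLinearMap := continuous_innerDual_mvfderiv g hV hb1
  have hIac : Continuous fun x ↦ g.innerDual x (mvfderiv (𝓡 n) a x).toLinearMap
      (mvfderiv (𝓡 n) b x).toLinearMap := continuous_innerDual_mvfderiv g ha hb1
  have hec : Continuous fun x ↦ Real.exp (-V x) := hexp.continuous
  have i1 : Integrable (fun x ↦ (a x * Real.exp (-V x)) * g.dalembertian b x) g.riemVolume :=
    integrable_of_continuous_of_hasCompactSupport' hg ((ha.continuous.mul hec).mul hΔc) huc.mul_right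
  have i2 : Integrable (fun x ↦ a x * g.innerDual x (mvfderiv (𝓡 n) V x).toLinearMap
      (mvfderiv (𝓡 n) b x).toLinearMap * Real.exp (-V x)) g.riemVolume :=
    integrable_of_continuous_of_hasCompactSupport' hg ((ha.continuous.mul hIVc).mul hec)
      (hac.mul_right.mul_right)
  have i3 : Integrable (fun x ↦ g.innerDual x (mvfderiv (𝓡 n) a x).toLinearMap
      (mvfderiv (𝓡 n) b x).toLinearMap * Real.exp (-V x)) g.riemVolume := by
    refine integrable_of_continuous_of_hasCompactSupport' hg (hIac.mul hec) ?_
    refine HasCompactSupport.mul_right ?_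
    exact HasCompactSupport.intro hac (fun x hx ↦ innerDual_mvfderiv_eq_zero_of_notMem_tsupport_left hx)
  -- split the integrals
  have s1 : ∫ x, a x * (g.dalembertian b x
        - g.innerDual x (mvfderiv (𝓡 n) V x).toLinearMap (mvfderiv (𝓡 n) b x).toLinearMap) *
        Real.exp (-V x) ∂g.riemVolume =
      ∫ x, ((a x * Real.exp (-V x)) * g.dalembertian b x
        - a x * g.innerDual x (mvfderiv (𝓡 n) V x).toLinearMap (mvfderiv (𝓡 n) b x).toLinearMap *
            Real.exp (-V x)) ∂g.riemVolume :=
    integral_congr_ae (Eventually.of_forall fun x ↦ by ring)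
  have s2 : ∫ x, ((a x * Real.exp (-V x)) * g.dalembertian b x
        - a x * g.innerDual x (mvfderiv (𝓡 n) V x).toLinearMap (mvfderiv (𝓡 n) b x).toLinearMap *
            Real.exp (-V x)) ∂g.riemVolume =
      ∫ x, (a x * Real.exp (-V x)) * g.dalembertian b x ∂g.riemVolume
      - ∫ x, a x * g.innerDual x (mvfderiv (𝓡 n) V x).toLinearMap (mvfderiv (𝓡 n) b x).toLinearMap *
            Real.exp (-V x) ∂g.riemVolume :=
    integral_sub i1 i2
  have s3 : ∫ x, g.innerDual x (mvfderiv (𝓡 n) (fun y ↦ a y * Real.exp (-V y)) x).toLinearMap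
        (mvfderiv (𝓡 n) b x).toLinearMap ∂g.riemVolume =
      ∫ x, (g.innerDual x (mvfderiv (𝓡 n) a x).toLinearMap (mvfderiv (𝓡 n) b x).toLinearMap *
          Real.exp (-V x)
        - a x * g.innerDual x (mvfderiv (𝓡 n) V x).toLinearMap (mvfderiv (𝓡 n) b x).toLinearMap *
            Real.exp (-V x)) ∂g.riemVolume :=
    integral_congr_ae (Eventually.of_forall hpt)
  have s4 : ∫ x, (g.innerDual x (mvfderiv (𝓡 n) a x).toLinearMap (mvfderiv (𝓡 n) b x).toLinearMap *
          Real.exp (-V x)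
        - a x * g.innerDual x (mvfderiv (𝓡 n) V x).toLinearMap (mvfderiv (𝓡 n) b x).toLinearMap *
            Real.exp (-V x)) ∂g.riemVolume =
      ∫ x, g.innerDual x (mvfderiv (𝓡 n) a x).toLinearMap (mvfderiv (𝓡 n) b x).toLinearMap *
          Real.exp (-V x) ∂g.riemVolume
      - ∫ x, a x * g.innerDual x (mvfderiv (𝓡 n) V x).toLinearMap (mvfderiv (𝓡 n) b x).toLinearMap *
            Real.exp (-V x) ∂g.riemVolume :=
    integral_sub i3 i2
  linarith [hG, s1, s2, s3, s4]

/-- **Weighted Green identity, compactly supported second factor**: `∫ a (L b) e^{-V} dV = −∫ g⁻¹(da, db) e^{-V} dV`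
for `a ∈ C¹`, `b ∈ C²_c`, `V ∈ C¹`. [cite: CarrilloNi2009, §4 (integration by parts on the complete soliton)] -/
theorem weightedGreen_right (hg : g.IsRiemannian) {a b V : M → ℝ}
    (ha : ContMDiff (𝓡 n) 𝓘(ℝ, ℝ) 1 a) (hb : ContMDiff (𝓡 n) 𝓘(ℝ, ℝ) 2 b) (hbc : HasCompactSupport b)
    (hV : ContMDiff (𝓡 n) 𝓘(ℝ, ℝ) 1 V) :
    ∫ x, a x * (g.dalembertian b x
        - g.innerDual x (mvfderiv (𝓡 n) V x).toLinearMap (mvfderiv (𝓡 n) b x).toLinearMap) *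
        Real.exp (-V x) ∂g.riemVolume =
      -∫ x, g.innerDual x (mvfderiv (𝓡 n) a x).toLinearMap (mvfderiv (𝓡 n) b x).toLinearMap *
          Real.exp (-V x) ∂g.riemVolume := by
  have hexp : ContMDiff (𝓡 n) 𝓘(ℝ, ℝ) 1 (fun y ↦ Real.exp (-V y)) :=
    ((Real.contDiff_exp.comp contDiff_neg).of_le le_top).comp_contMDiff hV
  have hu : ContMDiff (𝓡 n) 𝓘(ℝ, ℝ) 1 (fun y ↦ a y * Real.exp (-V y)) := ha.mul hexp
  have hG := integral_mul_dalembertian_of_hasCompactSupport_right hg hu hb hbc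
  have hb1 : ContMDiff (𝓡 n) 𝓘(ℝ, ℝ) 1 b := hb.of_le (by norm_num)
  have hpt : ∀ x, g.innerDual x (mvfderiv (𝓡 n) (fun y ↦ a y * Real.exp (-V y)) x).toLinearMap
        (mvfderiv (𝓡 n) b x).toLinearMap =
      g.innerDual x (mvfderiv (𝓡 n) a x).toLinearMap (mvfderiv (𝓡 n) b x).toLinearMap * Real.exp (-V x)
        - a x * g.innerDual x (mvfderiv (𝓡 n) V x).toLinearMap (mvfderiv (𝓡 n) b x).toLinearMap *
            Real.exp (-V x) := by
    intro x
    have h := mvfderiv_mul_exp_neg_toLinearMap (I := 𝓡 n) (ha.mdifferentiableAt one_ne_zero (x := x))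
      (hV.mdifferentiableAt one_ne_zero)
    rw [show (mvfderiv (𝓡 n) (fun y ↦ a y * Real.exp (-V y)) x).toLinearMap =
        (mvfderiv (𝓡 n) (fun y ↦ a y * Real.exp (-V y)) x : TangentSpace (𝓡 n) x →ₗ[ℝ] ℝ) from rfl, h,
      g.innerDual_sub_left, g.innerDual_smul_left, g.innerDual_smul_left]
    ring
  -- supports: everything involving `b` vanishes off `tsupport b`
  have hΔ0 : ∀ x ∉ tsupport b, g.dalembertian b x = 0 := fun x hx ↦
    g.dalembertian_eq_zero_of_notMem_tsupport hx
  have hΔc : Continuous (g.dalembertian b) := continuous_dalembertian g hb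
  have hIVc : Continuous fun x ↦ g.innerDual x (mvfderiv (𝓡 n) V x).toLinearMap
      (mvfderiv (𝓡 n) b x).toLinearMap := continuous_innerDual_mvfderiv g hV hb1
  have hIac : Continuous fun x ↦ g.innerDual x (mvfderiv (𝓡 n) a x).toLinearMap
      (mvfderiv (𝓡 n) b x).toLinearMap := continuous_innerDual_mvfderiv g ha hb1
  have hec : Continuous fun x ↦ Real.exp (-V x) := hexp.continuous
  have hΔsupp : HasCompactSupport (g.dalembertian b) := HasCompactSupport.intro hbc hΔ0
  have hIVsupp : HasCompactSupport fun x ↦ g.innerDual x (mvfderiv (𝓡 n) V x).toLinearMap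
      (mvfderiv (𝓡 n) b x).toLinearMap :=
    HasCompactSupport.intro hbc (fun x hx ↦ innerDual_mvfderiv_eq_zero_of_notMem_tsupport_right hx)
  have hIasupp : HasCompactSupport fun x ↦ g.innerDual x (mvfderiv (𝓡 n) a x).toLinearMap
      (mvfderiv (𝓡 n) b x).toLinearMap :=
    HasCompactSupport.intro hbc (fun x hx ↦ innerDual_mvfderiv_eq_zero_of_notMem_tsupport_right hx)
  have i1 : Integrable (fun x ↦ (a x * Real.exp (-V x)) * g.dalembertian b x) g.riemVolume :=
    integrable_of_continuous_of_hasCompactSupport' hg ((ha.continuous.mul hec).mul hΔc) hΔsupp.mul_left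
  have i2 : Integrable (fun x ↦ a x * g.innerDual x (mvfderiv (𝓡 n) V x).toLinearMap
      (mvfderiv (𝓡 n) b x).toLinearMap * Real.exp (-V x)) g.riemVolume :=
    integrable_of_continuous_of_hasCompactSupport' hg ((ha.continuous.mul hIVc).mul hec)
      (hIVsupp.mul_left.mul_right)
  have i3 : Integrable (fun x ↦ g.innerDual x (mvfderiv (𝓡 n) a x).toLinearMap
      (mvfderiv (𝓡 n) b x).toLinearMap * Real.exp (-V x)) g.riemVolume :=
    integrable_of_continuous_of_hasCompactSupport' hg (hIac.mul hec) hIasupp.mul_right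
  have s1 : ∫ x, a x * (g.dalembertian b x
        - g.innerDual x (mvfderiv (𝓡 n) V x).toLinearMap (mvfderiv (𝓡 n) b x).toLinearMap) *
        Real.exp (-V x) ∂g.riemVolume =
      ∫ x, ((a x * Real.exp (-V x)) * g.dalembertian b x
        - a x * g.innerDual x (mvfderiv (𝓡 n) V x).toLinearMap (mvfderiv (𝓡 n) b x).toLinearMap *
            Real.exp (-V x)) ∂g.riemVolume :=
    integral_congr_ae (Eventually.of_forall fun x ↦ by ring)
  have s2 : ∫ x, ((a x * Real.exp (-V x)) * g.dalembertian b x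
        - a x * g.innerDual x (mvfderiv (𝓡 n) V x).toLinearMap (mvfderiv (𝓡 n) b x).toLinearMap *
            Real.exp (-V x)) ∂g.riemVolume =
      ∫ x, (a x * Real.exp (-V x)) * g.dalembertian b x ∂g.riemVolume
      - ∫ x, a x * g.innerDual x (mvfderiv (𝓡 n) V x).toLinearMap (mvfderiv (𝓡 n) b x).toLinearMap *
            Real.exp (-V x) ∂g.riemVolume :=
    integral_sub i1 i2
  have s3 : ∫ x, g.innerDual x (mvfderiv (𝓡 n) (fun y ↦ a y * Real.exp (-V y)) x).toLinearMap
        (mvfderiv (𝓡 n) b x).toLinearMap ∂g.riemVolume =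
      ∫ x, (g.innerDual x (mvfderiv (𝓡 n) a x).toLinearMap (mvfderiv (𝓡 n) b x).toLinearMap *
          Real.exp (-V x)
        - a x * g.innerDual x (mvfderiv (𝓡 n) V x).toLinearMap (mvfderiv (𝓡 n) b x).toLinearMap *
            Real.exp (-V x)) ∂g.riemVolume :=
    integral_congr_ae (Eventually.of_forall hpt)
  have s4 : ∫ x, (g.innerDual x (mvfderiv (𝓡 n) a x).toLinearMap (mvfderiv (𝓡 n) b x).toLinearMap *
          Real.exp (-V x)
        - a x * g.innerDual x (mvfderiv (𝓡 n) V x).toLinearMap (mvfderiv (𝓡 n) b x).toLinearMap *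
            Real.exp (-V x)) ∂g.riemVolume =
      ∫ x, g.innerDual x (mvfderiv (𝓡 n) a x).toLinearMap (mvfderiv (𝓡 n) b x).toLinearMap *
          Real.exp (-V x) ∂g.riemVolume
      - ∫ x, a x * g.innerDual x (mvfderiv (𝓡 n) V x).toLinearMap (mvfderiv (𝓡 n) b x).toLinearMap *
            Real.exp (-V x) ∂g.riemVolume :=
    integral_sub i3 i2
  linarith [hG, s1, s2, s3, s4]

end Green

/-! ## Registered helpers (verbatim signatures) -/

/-- Registered helper `helper_weightedGreen_left`: the weighted Green identity `∫ a (L b) e^{-V} = −∫ ⟨da, db⟩ e^{-V}`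
with `a` compactly supported, on a (non-compact) Riemannian manifold modelled on `ℝⁿ`.
[cite: CarrilloNi2009, §4 (integration by parts on the complete soliton)] -/
theorem helper_weightedGreen_left : ∀ (n : ℕ) (M : Type*) [TopologicalSpace M] [T2Space M] [SecondCountableTopology M] [ChartedSpace (EuclideanSpace ℝ (Fin n)) M] [IsManifold (𝓡 n) ∞ M] [T3Space M] [MeasurableSpace M] [BorelSpace M] (g : PseudoRiemannianMetric (𝓡 n) ∞ (EuclideanSpace ℝ (Fin n)) (TangentSpace (𝓡 n) : M → Type _)) [g.HasLeviCivita] (V : M → ℝ), g.IsRiemannian → ContMDiff (𝓡 n) 𝓘(ℝ, ℝ) 1 V → ∀ (a b : M → ℝ), ContMDiff (𝓡 n) 𝓘(ℝ, ℝ) 1 a → HasCompactSupport a → ContMDiff (𝓡 n) 𝓘(ℝ, ℝ) 2 b → ∫ x, a x * (g.dalembertian b x - g.innerDual x (mvfderiv (𝓡 n) V x).toLinearMap (mvfderiv (𝓡 n) b x).toLinearMap) * Real.exp (-V x) ∂g.riemVolume = -∫ x, g.innerDual x (mvfderiv (𝓡 n) a x).toLinearMap (mvfderiv (𝓡 n)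 b x).toLinearMap * Real.exp (-V x) ∂g.riemVolume := by
  intro n M _ _ _ _ _ _ _ _ g _ V hg hV a b ha hac hb
  exact weightedGreen_left hg ha hac hb hV

/-- Registered helper `helper_weightedGreen_right`: the weighted Green identity `∫ a (L b) e^{-V} = −∫ ⟨da, db⟩ e^{-V}`
with `b` compactly supported, on a (non-compact) Riemannian manifold modelled on `ℝⁿ`.
[cite: CarrilloNi2009, §4 (integration by parts on the complete soliton)] -/
theorem helper_weightedGreen_right : ∀ (n : ℕ) (M : Type*) [TopologicalSpace M] [T2Space M] [SecondCountableTopology M] [ChartedSpace (EuclideanSpace ℝ (Fin n)) M] [IsManifold (𝓡 n) ∞ M] [T3Space M] [MeasurableSpace M] [BorelSpace M] (g : PseudoRiemannianMetric (𝓡 n) ∞ (EuclideanSpace ℝ (Fin n)) (TangentSpace (𝓡 n) : M → Type _)) [g.HasLeviCivita] (V : M → ℝ), g.IsRiemannian → ContMDiff (𝓡 n) 𝓘(ℝ, ℝ) 1 V → ∀ (a b : M → ℝ), ContMDiff (𝓡 n) 𝓘(ℝ, ℝ) 1 a → ContMDiff (𝓡 n) 𝓘(ℝ, ℝ) 2 b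 → HasCompactSupport b → ∫ x, a x * (g.dalembertian b x - g.innerDual x (mvfderiv (𝓡 n) V x).toLinearMap (mvfderiv (𝓡 n) b x).toLinearMap) * Real.exp (-V x) ∂g.riemVolume = -∫ x, g.innerDual x (mvfderiv (𝓡 n) a x).toLinearMap (mvfderiv (𝓡 n) b x).toLinearMap * Real.exp (-V x) ∂g.riemVolume := by
  intro n M _ _ _ _ _ _ _ _ g _ V hg hV a b ha hb hbc
  exact weightedGreen_right hg ha hb hbc hV

end Summit.SmoothPoincare4.SmoothPoincare4.Theorems.NoncompactShrinkerGapHeat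

end
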